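import Summits.BirchSwinnertonDyer.Rank1Residual.P2.CongruentNumberSilentEvenFiveThetaCMReduced
import Literature.NumberTheory.EllipticCurves.TianYuanZhang2017.CMPointClassFieldTorsion
import HarnessLib

/-!
# Cell `bsd-monsky` (typer), route B: C-P2-1 on `𝒮⁻` from the TWICE-REDUCED class-field display ALONE — the offered
# corner (`…_of_cmPointClassFieldDataReduced_descent (hCF′)`, OFFER-M v1.15) with the «`#A(ℍ′_n)[4] = 16`» half of
# Lemma 3.18 struck as well

HONEST FRAMING (cell `bsd-monsky`, run/shared/lean/pub/bsd-monsky/; README §1): ONE theorem on ONE explicit infinite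
family of quadratic twists of the congruent number curve at the prime `2`; not "BSD for rank ≤ 1", nothing at odd primes;
nothing is booked by this file. The corner of record of route B (referee B ROUND 681) is
`congruentSilentEvenFiveBSDTwo_of_cmPointClassFieldData_descent (hCF)`; the corner offered in OFFER-M v1.15 is
`congruentSilentEvenFiveBSDTwo_of_cmPointClassFieldDataReduced_descent (hCF′)`. A second derivability pass
(`Literature/…/TianYuanZhang2017/CMPointClassFieldTorsion.lean`, on `…/CurveAFourTorsion.lean`) found the half
«`#A(ℍ′_n)[4] = 16`» of Lemma 3.18 (`n` even) to be a kernel theorem of the data alone (`i, √−2 ∈ ℍ′_n`, so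
`ℚ(ζ₈) ⊂ ℍ′_n`, over which `A : Y² = X³ + 4X` has exactly sixteen `4`-torsion points), and two rendering redundancies
(«`2(2Q) = 0`» for torsion `Q`, `n` odd, from «`2Q ∈ {0, τ(1)}`»; «`c(i) = −i`» from «`c(√−d′) = −√−d′`» at `d′ = 1`);
`tyz_cmPointClassFieldDataTorsion` (`hCF″`) is `hCF′` without those three conjuncts, and the named facts are EQUIVALENT in
the kernel (`tyz_cmPointClassFieldDataReduced_iff_torsion`, `tyz_cmPointClassFieldData_iff_torsion`). This file is the
corner on the twice-reduced display: `congruentSilentEvenFiveBSDTwo_of_cmPointClassFieldDataTorsion_descent (hCF″)`, with the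
sharper form, clause (a) and the pair form from the same binder (proofs: one-line compositions of the v1.15 corner / its
twins with `tyz_cmPointClassFieldDataReduced_of_torsion`). Marks of record untouched (route B: NONE). CONDITIONAL on the one
(twice-reduced) display; nothing asserted; the conjecture `Prop`s stay `@[conjecture]`.
[cite: TianYuanZhang2017, §3.1 (J738–J739), Prop. 3.2 (1)(2)(3), Prop. 3.4, Thm. 3.5 (J741) and its proof (p0020 L106–L165, p0021 L1–L5), Thm. 3.6 (1)(2), Lemma 3.16 (p0017 L98–L113), Lemma 3.18 (p0017 L152–L153), Lemma 3.21 and its proof (J759)]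
[cite: Cox2013, Theorem 6.1 (ii) and Theorem 9.18] [cite: SilvermanAEC2009, III.2.3, III.6.4, Prop. X.1.4, Prop. X.4.9, Thm. X.4.2]
[cite: Miller2011LMS, Def. 1.1 (arXiv:1010.2431 p. 3)]
-/

noncomputable section

open scoped Classical

open WeierstrassCurve Literature.NumberTheory.EllipticCurves
  Literature.NumberTheory.EllipticCurves.TianYuanZhang2017

set_option autoImplicit false

namespace Summit.BirchSwinnertonDyer.Rank1Residual.P2

open Conjectures

/-! ## §1 C-P2-1 on `𝒮⁻` from the twice-reduced class-field display ALONE -/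

/-- **C-P2-1 = Theorem 1.1 on `𝒮⁻` (`ord_{s=1} L(E_{2pq}, s) = 1 ∧ BSD(E_{2pq}, 2)`) from `tyz_cmPointClassFieldDataTorsion`
ALONE** — the v1.15 corner (`…_of_cmPointClassFieldDataReduced_descent (hCF′)`) with the «`#A(ℍ′_n)[4] = 16`» half of
Lemma 3.18 and two rendering redundancies struck from the displayed hypothesis as well (kernel theorems of the data and of
the other displayed sentences); the `2`-Selmer input is the tree's complete `2`-descent. CONDITIONAL on the one display;
nothing asserted. [cite: TianYuanZhang2017, §1 ((1.1)), Thm. 3.5 and its proof (p0020 L106–p0021 L5), Prop. 3.2, Thm. 3.6, Lemma 3.18]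
[cite: Cox2013, Theorem 6.1 (ii) and Theorem 9.18] [cite: SilvermanAEC2009, III.2.3, III.6.4, Prop. X.1.4, Prop. X.4.9, Thm. X.4.2]
[cite: Miller2011LMS, Def. 1.1 (arXiv:1010.2431 p. 3)] -/
theorem congruentSilentEvenFiveBSDTwo_of_cmPointClassFieldDataTorsion_descent
    (hCF : tyz_cmPointClassFieldDataTorsion) : CongruentSilentEvenFiveBSDTwo :=
  congruentSilentEvenFiveBSDTwo_of_cmPointClassFieldDataReduced_descent
    (tyz_cmPointClassFieldDataReduced_of_torsion hCF)

/-! ## §2 The sharper form, clause (a) and the pair form from the twice-reduced display ALONE -/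

/-- **C-P2-1, sharper (`Ш_an`-unit) form, on `𝒮⁻` from `tyz_cmPointClassFieldDataTorsion` ALONE.** CONDITIONAL; nothing
asserted. [cite: TianYuanZhang2017, §1 ((1.1)), Thm. 3.5, Prop. 3.2, Thm. 3.6, Lemma 3.18] [cite: Cox2013, Theorem 6.1 (ii) and Theorem 9.18]
[cite: SilvermanAEC2009, Prop. X.1.4, Prop. X.4.9] -/
theorem congruentSilentEvenFiveOrdTwo_of_cmPointClassFieldDataTorsion_descent
    (hCF : tyz_cmPointClassFieldDataTorsion) : CongruentSilentEvenFiveOrdTwo :=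
  congruentSilentEvenFiveOrdTwo_of_cmPointClassFieldDataReduced_descent
    (tyz_cmPointClassFieldDataReduced_of_torsion hCF)

/-- **Clause (a) on all of `𝒮⁻` from the twice-reduced display alone**: `ord_{s=1} L(E_{2pq}, s) = 1`. CONDITIONAL; nothing
asserted. [cite: TianYuanZhang2017, Thm. 3.5, Prop. 3.2, Thm. 3.6, Lemma 3.18, Lemma 3.21] [cite: Cox2013, Theorem 6.1 (ii) and Theorem 9.18] -/
theorem analyticRank_eq_one_sMinus_of_cmPointClassFieldDataTorsion (hCF : tyz_cmPointClassFieldDataTorsion)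
    {p q : ℕ} (hp : p.Prime) (hq : q.Prime) (hp5 : p % 8 = 5) (hq4 : q % 4 = 3) (hj : jacobiSym p q = -1) :
    (congruentNumberCurve (2 * (p * q))).analyticRank = 1 :=
  analyticRank_eq_one_sMinus_of_cmPointClassFieldDataReduced (tyz_cmPointClassFieldDataReduced_of_torsion hCF) hp hq
    hp5 hq4 hj

/-- **Both typed forms of C-P2-1 on `𝒮⁻` from `tyz_cmPointClassFieldDataTorsion` ALONE.** CONDITIONAL; nothing asserted.
[cite: TianYuanZhang2017, Thm. 3.5, Prop. 3.2, Thm. 3.6, Lemma 3.18] [cite: Cox2013, Theorem 6.1 (ii) and Theorem 9.18]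
[cite: SilvermanAEC2009, Prop. X.1.4, Prop. X.4.9] -/
theorem congruentSilentEvenFive_pair_of_cmPointClassFieldDataTorsion_descent
    (hCF : tyz_cmPointClassFieldDataTorsion) : CongruentSilentEvenFiveOrdTwo ∧ CongruentSilentEvenFiveBSDTwo :=
  ⟨congruentSilentEvenFiveOrdTwo_of_cmPointClassFieldDataTorsion_descent hCF,
    congruentSilentEvenFiveBSDTwo_of_cmPointClassFieldDataTorsion_descent hCF⟩

/-! ## §3 The corners are interchangeable (the displayed facts are equivalent in the kernel) -/

/-- **The reduced corner and the twice-reduced corner are the same theorem read through equivalent displays**: C-P2-1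
follows from `hCF′` iff it follows from `hCF″` (`tyz_cmPointClassFieldDataReduced_iff_torsion`).
[cite: TianYuanZhang2017, §3, Lemma 3.18] -/
theorem cmPointClassFieldDataReduced_imp_bsdTwo_iff_torsion_imp_bsdTwo :
    (tyz_cmPointClassFieldDataReduced → CongruentSilentEvenFiveBSDTwo) ↔
      (tyz_cmPointClassFieldDataTorsion → CongruentSilentEvenFiveBSDTwo) :=
  ⟨fun h hT => h (tyz_cmPointClassFieldDataReduced_of_torsion hT),
    fun h hR => h (tyz_cmPointClassFieldDataTorsion_of_reduced hR)⟩

end Summit.BirchSwinnertonDyer.Rank1Residual.P2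

end
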